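import Summits.Ventures.WeilGRH.TwistedSechColumns
import Summits.Ventures.WeilGRH.TwistedTailOdd
import Summits.Ventures.WeilGRH.TwistedOddParityTailEven
import Summits.RiemannHypothesis.RiemannHypothesis.Theorems.WeilFormatCSchurStep
import HarnessLib

/-!
# GRH arm (rh-explicit, venture WeilGRH): twisted format C with the PARITY-1 kernel — the odd-sector tail majorant

Cell `rh-explicit`, WEIL TRACK — GRH ARM (engine seat weil-grh-2 gen8).  Companion of weil-grh-5's
`TwistedOddParityTailEven.lean` (`oddParity_even_tail_majorant_matrix`, the `hU2e` input of
`weilPositivityOnChar_of_twistedOdd_formatC_data`): the ODD-sector input `hU2o`.  The odd SectorSplit column of the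
parity-1 kernel `twistedGramCoeffOdd χ a` at a far mode `l ≥ B₃ ≥ 2B` is the parity-0 column plus the bonus column
`Π⁻(·,l)` with `|Π⁻(k,l)| ≤ 8a/(3π²(k+1)(l+1))` (`TwistedSechColumns.abs_sechBonus_oddCol_le`; the odd bonus column is
only `O(1/l)`, not `O(1/l²)`).  Plain Cauchy–Schwarz over the block (`Σ_{k<B} (k+1)⁻² ≤ 2`), the telescoping bound
`Σ_{l∈Ico B₃ N} (l+1)⁻² ≤ 1/B₃` (`sum_Ico_inv_succ_sq_le`) and Peter–Paul with a free `θ' > 0` against weil-grh-5's parity-0 majorant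
`odd_twisted_tail_majorant_matrix` (`TwistedTailOdd.lean`, free `θ > 0`) give

* `sechBonus_odd_tail_le` — `Σ_{l∈Ico B₃ N} (Σ_k Π⁻(k,l) x_k)²/d(l) ≤ (2(8a/(3π²))²/(d₀B₃))·Σ x_k²`;
* `oddParity_odd_tail_majorant_matrix` — for weights `d(l) ≥ d₀ > 0` on `l ≥ B₃`:
  `Σ_{l∈Ico B₃ N} (Σ_k M⁻_odd(k,l) x_k)²/d(l) ≤ xᵀ U₂⁻ x`,
  `U₂⁻ = (1+θ')·U₂⁻[parity 0](θ) + (1+θ'⁻¹)·(2(8a/(3π²))²/(d₀B₃))·I` — an explicit `B × B` matrix (ISOTROPIC bonus part: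
  by weil-grh-2 gen8's twin the four cells `(−3/·) @ 18/25, 3/4, 4023/5000, (log 5)/2` of the real finite remainder need the
  parity bonus in BOTH sectors, and their soft direction sits on the low modes, where an isotropic bound beats the
  `card`-weighted diagonal one by the factor `B/2`).

No definitions; no named facts; RH/GRH-free; standard axioms.
-/

set_option autoImplicit false

noncomputable section

open Complex Finset Matrix MeasureTheory Set
open scoped Real BigOperators ComplexConjugate ArithmeticFunction.vonMangoldt

namespace Summit.Ventures.WeilGRH

open Literature.NumberTheory.LFunctions
open Literature.NumberTheory.LFunctions.Yoshida1992 (freq archExpSumSin)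
open Literature.Analysis.SpecialFunctions
open Summit.RiemannHypothesis.RiemannHypothesis.Theorems.WeilFormatC

variable {q : ℕ} {a : ℝ}

/-- The odd SectorSplit kernel of `twistedGramCoeffOdd` = that of `twistedGramCoeff` + that of the bonus block. -/
theorem oddKernel_twistedGramCoeffOdd_eq (χ : DirichletCharacter ℂ q) (a : ℝ) (k l : ℕ) :
    (twistedGramCoeffOdd χ a ((k : ℤ) + 1) ((l : ℤ) + 1) - twistedGramCoeffOdd χ a ((k : ℤ) + 1) (-((l : ℤ) + 1))) / 2
      = (twistedGramCoeff χ a ((k : ℤ) + 1) ((l : ℤ) + 1) - twistedGramCoeff χ a ((k : ℤ) + 1) (-((l : ℤ) + 1))) / 2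
        + (((if ((k : ℤ) + 1) = ((l : ℤ) + 1) then π else 0) - sechIncrCoeff a ((k : ℤ) + 1) ((l : ℤ) + 1))
            - ((if ((k : ℤ) + 1) = -((l : ℤ) + 1) then π else 0) - sechIncrCoeff a ((k : ℤ) + 1) (-((l : ℤ) + 1)))) / 2 := by
  unfold twistedGramCoeffOdd
  split_ifs <;> ring

/-- `Σ_{l∈Ico B₃ N} 1/(l+1)² ≤ 1/B₃` for `1 ≤ B₃` (every `N`; telescoping `1/(l+1)² ≤ 1/l − 1/(l+1)`). -/
theorem sum_Ico_inv_succ_sq_le {B₃ : ℕ} (hB₃ : 1 ≤ B₃) (N : ℕ) :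
    ∑ l ∈ Finset.Ico B₃ N, 1 / ((l : ℝ) + 1) ^ 2 ≤ 1 / (B₃ : ℝ) := by
  by_cases hN : B₃ ≤ N
  · -- the telescoping bound with the remainder `1/N`
    have key : ∀ M, B₃ ≤ M → ∑ l ∈ Finset.Ico B₃ M, 1 / ((l : ℝ) + 1) ^ 2 ≤ 1 / (B₃ : ℝ) - 1 / (M : ℝ) := by
      intro M hM
      induction M, hM using Nat.le_induction with
      | base => simp
      | succ M hBM ih =>
        rw [Finset.sum_Ico_succ_top hBM]
        have hM0 : (0 : ℝ) < M := by exact_mod_cast (show 0 < M by omega)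
        have hstep : 1 / ((M : ℝ) + 1) ^ 2 ≤ 1 / (M : ℝ) - 1 / ((M : ℝ) + 1) := by
          rw [div_sub_div _ _ hM0.ne' (by positivity), div_le_div_iff₀ (by positivity) (by positivity)]
          nlinarith
        push_cast
        linarith
    have h := key N hN
    have hN0 : (0 : ℝ) ≤ 1 / (N : ℝ) := by positivity
    linarith
  · rw [Finset.Ico_eq_empty_of_le (by omega), Finset.sum_empty]
    positivity

/-- **The bonus part of the odd-sector tail**: `Σ_{l∈Ico B₃ N} (Σ_k Π⁻(k,l) x_k)²/d(l) ≤ (2(8a/(3π²))²/(d₀B₃))·Σ x_k²`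
for `2B ≤ B₃`, `1 ≤ B₃`, `d(l) ≥ d₀ > 0`. -/
theorem sechBonus_odd_tail_le (ha : 0 < a) {B B₃ : ℕ} (hBB : 2 * B ≤ B₃) (hB₃ : 1 ≤ B₃) (d : ℕ → ℝ) {d₀ : ℝ}
    (hd₀ : 0 < d₀) (hd : ∀ l, B₃ ≤ l → d₀ ≤ d l) (N : ℕ) (x : Fin B → ℝ) :
    ∑ l ∈ Finset.Ico B₃ N, (∑ k : Fin B,
        ((((if (((k : ℕ) : ℤ) + 1) = ((l : ℤ) + 1) then π else 0) - sechIncrCoeff a (((k : ℕ) : ℤ) + 1) ((l : ℤ) + 1))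
          - ((if (((k : ℕ) : ℤ) + 1) = -((l : ℤ) + 1) then π else 0) - sechIncrCoeff a (((k : ℕ) : ℤ) + 1) (-((l : ℤ) + 1)))) / 2)
          * x k) ^ 2 / d l
      ≤ 2 * (8 * a / (3 * π ^ 2)) ^ 2 / (d₀ * (B₃ : ℝ)) * ∑ k, x k ^ 2 := by
  have hx : 0 ≤ ∑ k : Fin B, x k ^ 2 := Finset.sum_nonneg fun k _ ↦ sq_nonneg _
  -- `Σ_{k<B} 1/(k+1)² ≤ 2`
  have hfin : ∑ k : Fin B, 1 / (((k : ℕ) : ℝ) + 1) ^ 2 ≤ 2 := by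
    rw [Fin.sum_univ_eq_sum_range (fun i : ℕ ↦ 1 / ((i : ℝ) + 1) ^ 2) B, Finset.range_eq_Ico]
    by_cases hB : 1 ≤ B
    · rw [← Finset.sum_Ico_consecutive _ (Nat.zero_le 1) hB, Finset.sum_Ico_succ_top (le_refl 0),
        Finset.Ico_self, Finset.sum_empty]
      have h := sum_Ico_inv_succ_sq_le (le_refl 1) B
      push_cast at h ⊢
      norm_num at h ⊢
      linarith
    · rw [Finset.Ico_eq_empty_of_le (by omega), Finset.sum_empty]
      norm_num
  -- per column: plain Cauchy–Schwarz with `|Π⁻(k,l)| ≤ 8a/(3π²(k+1)(l+1))` and `Σ_k (k+1)⁻² ≤ 2`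
  have hcol : ∀ l ∈ Finset.Ico B₃ N, (∑ k : Fin B,
      ((((if (((k : ℕ) : ℤ) + 1) = ((l : ℤ) + 1) then π else 0) - sechIncrCoeff a (((k : ℕ) : ℤ) + 1) ((l : ℤ) + 1))
        - ((if (((k : ℕ) : ℤ) + 1) = -((l : ℤ) + 1) then π else 0) - sechIncrCoeff a (((k : ℕ) : ℤ) + 1) (-((l : ℤ) + 1)))) / 2)
        * x k) ^ 2 / d l
      ≤ (2 * (8 * a / (3 * π ^ 2)) ^ 2 / d₀ * ∑ k, x k ^ 2) * (1 / ((l : ℝ) + 1) ^ 2) := by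
    intro l hl
    rw [Finset.mem_Ico] at hl
    have hdl : d₀ ≤ d l := hd l hl.1
    have hdpos : 0 < d l := hd₀.trans_le hdl
    have hl0 : (0 : ℝ) < (l : ℝ) + 1 := by positivity
    -- Cauchy–Schwarz
    have hcs := Finset.sum_mul_sq_le_sq_mul_sq (Finset.univ : Finset (Fin B))
      (fun k : Fin B ↦ ((((if (((k : ℕ) : ℤ) + 1) = ((l : ℤ) + 1) then π else 0) - sechIncrCoeff a (((k : ℕ) : ℤ) + 1) ((l : ℤ) + 1))
        - ((if (((k : ℕ) : ℤ) + 1) = -((l : ℤ) + 1) then π else 0) - sechIncrCoeff a (((k : ℕ) : ℤ) + 1) (-((l : ℤ) + 1)))) / 2))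
      x
    -- bound the kernel squares
    have hker : ∑ k : Fin B, ((((if (((k : ℕ) : ℤ) + 1) = ((l : ℤ) + 1) then π else 0) - sechIncrCoeff a (((k : ℕ) : ℤ) + 1) ((l : ℤ) + 1))
        - ((if (((k : ℕ) : ℤ) + 1) = -((l : ℤ) + 1) then π else 0) - sechIncrCoeff a (((k : ℕ) : ℤ) + 1) (-((l : ℤ) + 1)))) / 2) ^ 2
        ≤ (8 * a / (3 * π ^ 2)) ^ 2 / ((l : ℝ) + 1) ^ 2 * 2 := by
      have hk : ∀ k : Fin B, ((((if (((k : ℕ) : ℤ) + 1) = ((l : ℤ) + 1) then π else 0) - sechIncrCoeff a (((k : ℕ) : ℤ) + 1) ((l : ℤ) + 1))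
          - ((if (((k : ℕ) : ℤ) + 1) = -((l : ℤ) + 1) then π else 0) - sechIncrCoeff a (((k : ℕ) : ℤ) + 1) (-((l : ℤ) + 1)))) / 2) ^ 2
          ≤ (8 * a / (3 * π ^ 2)) ^ 2 / ((l : ℝ) + 1) ^ 2 * (1 / (((k : ℕ) : ℝ) + 1) ^ 2) := by
        intro k
        have hkl : 2 * ((k : ℕ) + 1) ≤ l + 1 := by omega
        have hb := abs_sechBonus_oddCol_le ha hkl
        have hk0 : (0 : ℝ) < ((k : ℕ) : ℝ) + 1 := by positivity
        have e : (8 * a / (3 * π ^ 2)) ^ 2 / ((l : ℝ) + 1) ^ 2 * (1 / (((k : ℕ) : ℝ) + 1) ^ 2)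
            = (8 * a / (3 * π ^ 2 * ((((k : ℕ) : ℝ) + 1) * ((l : ℝ) + 1)))) ^ 2 := by
          field_simp
        rw [e, ← sq_abs]
        exact pow_le_pow_left₀ (abs_nonneg _) hb 2
      refine (Finset.sum_le_sum fun k _ ↦ hk k).trans ?_
      rw [← Finset.mul_sum]
      exact mul_le_mul_of_nonneg_left hfin (by positivity)
    rw [div_le_iff₀ hdpos]
    refine hcs.trans ?_
    have hK : 0 ≤ 2 * (8 * a / (3 * π ^ 2)) ^ 2 / d₀ * ∑ k : Fin B, x k ^ 2 := by positivity
    calc (∑ k : Fin B, ((((if (((k : ℕ) : ℤ) + 1) = ((l : ℤ) + 1) then π else 0) - sechIncrCoeff a (((k : ℕ) : ℤ) + 1) ((l : ℤ) + 1))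
          - ((if (((k : ℕ) : ℤ) + 1) = -((l : ℤ) + 1) then π else 0) - sechIncrCoeff a (((k : ℕ) : ℤ) + 1) (-((l : ℤ) + 1)))) / 2) ^ 2)
          * ∑ k : Fin B, x k ^ 2
        ≤ ((8 * a / (3 * π ^ 2)) ^ 2 / ((l : ℝ) + 1) ^ 2 * 2) * ∑ k : Fin B, x k ^ 2 :=
          mul_le_mul_of_nonneg_right hker hx
      _ = (2 * (8 * a / (3 * π ^ 2)) ^ 2 / d₀ * ∑ k : Fin B, x k ^ 2) * (1 / ((l : ℝ) + 1) ^ 2) * d₀ := by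
          field_simp
      _ ≤ (2 * (8 * a / (3 * π ^ 2)) ^ 2 / d₀ * ∑ k : Fin B, x k ^ 2) * (1 / ((l : ℝ) + 1) ^ 2) * d l :=
          mul_le_mul_of_nonneg_left hdl (by positivity)
  refine (Finset.sum_le_sum hcol).trans ?_
  rw [← Finset.mul_sum]
  have htail := sum_Ico_inv_succ_sq_le hB₃ N
  have hK : 0 ≤ 2 * (8 * a / (3 * π ^ 2)) ^ 2 / d₀ * ∑ k : Fin B, x k ^ 2 := by positivity
  refine (mul_le_mul_of_nonneg_left htail hK).trans (le_of_eq ?_)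
  have hB0 : (0 : ℝ) < B₃ := by exact_mod_cast hB₃
  field_simp

/-- **Odd-sector tail majorant for the parity-1 kernel as `xᵀU₂⁻x`** (free Peter–Paul parameters `θ, θ' > 0`). -/
theorem oddParity_odd_tail_majorant_matrix (χ : DirichletCharacter ℂ q) (ha : 0 < a) {B B₃ : ℕ} (hBB : 2 * B ≤ B₃)
    (hB₃ : 1 ≤ B₃) (d : ℕ → ℝ) {d₀ : ℝ} (hd₀ : 0 < d₀) (hd : ∀ l, B₃ ≤ l → d₀ ≤ d l) {θ θ' : ℝ} (hθ : 0 < θ)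
    (hθ' : 0 < θ') (N : ℕ) (x : Fin B → ℝ) :
    ∑ l ∈ Finset.Ico B₃ N, (∑ k : Fin B,
        ((twistedGramCoeffOdd χ a (((k : ℕ) : ℤ) + 1) ((l : ℤ) + 1) -
          twistedGramCoeffOdd χ a (((k : ℕ) : ℤ) + 1) (-((l : ℤ) + 1))) / 2) * x k) ^ 2 / d l
      ≤ x ⬝ᵥ (Matrix.of fun k k' : Fin B ↦
          (1 + θ') * ((1 + θ) * (1 / (d₀ * B₃)) *
            (((-1 : ℝ) ^ ((k : ℕ) + 1) *
              (-(∑ j ∈ weilPrimeIndex a, (χ (j : ZMod q)).re * ((Λ j : ℝ) / Real.sqrt j) *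
                    Real.sin (freq a (((k : ℕ) : ℤ) + 1) * Real.log j)) / π
                - (Complex.digamma (1 / 4 + ((freq a (((k : ℕ) : ℤ) + 1) : ℝ) : ℂ) / 2 * I)).im / (2 * π)
                + archExpSumSin a (((k : ℕ) : ℤ) + 1) / π))
              * ((-1 : ℝ) ^ ((k' : ℕ) + 1) *
              (-(∑ j ∈ weilPrimeIndex a, (χ (j : ZMod q)).re * ((Λ j : ℝ) / Real.sqrt j) *
                    Real.sin (freq a (((k' : ℕ) : ℤ) + 1) * Real.log j)) / π
                - (Complex.digamma (1 / 4 + ((freq a (((k' : ℕ) : ℤ) + 1) : ℝ) : ℂ) / 2 * I)).im / (2 * π)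
                + archExpSumSin a (((k' : ℕ) : ℤ) + 1) / π)))
          + (if k = k' then (1 + θ⁻¹) * (B / (d₀ * ((((B₃ : ℝ) + 1) ^ 2) * (B₃ : ℝ))))
              * (2 * ((k : ℕ) + 1 : ℕ) * (∑ j ∈ weilPrimeIndex a, (Λ j : ℝ) / Real.sqrt j) / π
                + ((((k : ℕ) + 1 : ℕ) : ℝ) / 2 + 4 * a * (1 + weilArchDensity (2 * a)) / (3 * π ^ 2))) ^ 2
            else 0))
          + (if k = k' then (1 + θ'⁻¹) * (2 * (8 * a / (3 * π ^ 2)) ^ 2 / (d₀ * (B₃ : ℝ))) else 0)) *ᵥ x := by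
  have h0 := odd_twisted_tail_majorant_matrix χ ha hBB hB₃ d hd₀ hd hθ N x
  have h1 := sechBonus_odd_tail_le ha hBB hB₃ d hd₀ hd N x
  -- Peter–Paul per column
  have hpp : ∀ l ∈ Finset.Ico B₃ N, (∑ k : Fin B,
      ((twistedGramCoeffOdd χ a (((k : ℕ) : ℤ) + 1) ((l : ℤ) + 1) -
        twistedGramCoeffOdd χ a (((k : ℕ) : ℤ) + 1) (-((l : ℤ) + 1))) / 2) * x k) ^ 2 / d l
      ≤ (1 + θ') * ((∑ k : Fin B,
          ((twistedGramCoeff χ a (((k : ℕ) : ℤ) + 1) ((l : ℤ) + 1) -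
            twistedGramCoeff χ a (((k : ℕ) : ℤ) + 1) (-((l : ℤ) + 1))) / 2) * x k) ^ 2 / d l)
        + (1 + θ'⁻¹) * ((∑ k : Fin B,
          ((((if (((k : ℕ) : ℤ) + 1) = ((l : ℤ) + 1) then π else 0) - sechIncrCoeff a (((k : ℕ) : ℤ) + 1) ((l : ℤ) + 1))
            - ((if (((k : ℕ) : ℤ) + 1) = -((l : ℤ) + 1) then π else 0) - sechIncrCoeff a (((k : ℕ) : ℤ) + 1) (-((l : ℤ) + 1)))) / 2)
            * x k) ^ 2 / d l) := by
    intro l hl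
    rw [Finset.mem_Ico] at hl
    have hdpos : 0 < d l := hd₀.trans_le (hd l hl.1)
    have hsplit : (∑ k : Fin B,
        ((twistedGramCoeffOdd χ a (((k : ℕ) : ℤ) + 1) ((l : ℤ) + 1) -
          twistedGramCoeffOdd χ a (((k : ℕ) : ℤ) + 1) (-((l : ℤ) + 1))) / 2) * x k)
        = (∑ k : Fin B,
          ((twistedGramCoeff χ a (((k : ℕ) : ℤ) + 1) ((l : ℤ) + 1) -
            twistedGramCoeff χ a (((k : ℕ) : ℤ) + 1) (-((l : ℤ) + 1))) / 2) * x k)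
          + ∑ k : Fin B,
          ((((if (((k : ℕ) : ℤ) + 1) = ((l : ℤ) + 1) then π else 0) - sechIncrCoeff a (((k : ℕ) : ℤ) + 1) ((l : ℤ) + 1))
            - ((if (((k : ℕ) : ℤ) + 1) = -((l : ℤ) + 1) then π else 0) - sechIncrCoeff a (((k : ℕ) : ℤ) + 1) (-((l : ℤ) + 1)))) / 2)
            * x k := by
      rw [← Finset.sum_add_distrib]
      refine Finset.sum_congr rfl fun k _ ↦ ?_
      rw [oddKernel_twistedGramCoeffOdd_eq]
      ring
    rw [hsplit, mul_div_assoc', mul_div_assoc', ← add_div]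
    exact div_le_div_of_nonneg_right (sq_add_le_peterPaul hθ') hdpos.le
  refine (Finset.sum_le_sum hpp).trans ?_
  rw [Finset.sum_add_distrib, ← Finset.mul_sum, ← Finset.mul_sum]
  have hθ'1 : 0 ≤ 1 + θ' := by linarith
  have hθ'2 : 0 ≤ 1 + θ'⁻¹ := by have := inv_pos.mpr hθ'; linarith
  refine (add_le_add (mul_le_mul_of_nonneg_left h0 hθ'1) (mul_le_mul_of_nonneg_left h1 hθ'2)).trans (le_of_eq ?_)
  rw [quadForm_smul_add_diag]
  rfl

end Summit.Ventures.WeilGRH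

end
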